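import Summits.QuantumFields.YangMills.Theorems.BalabanUVNodesN15TwoGridOutputSwap
import HarnessLib

/-!
# Route «BalabanUVNodes», node N15 = NE2, -a lane, part 57: THE MEAN-VALUE IDENTITY OF THE DIFFERENCE QUOTIENT, ITERATED COARSE SHIFTS THROUGH KING's PROLONGATION,
# AND THE GRADIENT-OUTPUT SWAP `(∇′_νP̂₂ − P∇_ν)∘G = (ρ′(a_νΠ_{μ≠ν}a_μ²) − 1)∘P∘∇_ν∘G = O(η^α)` IN BLOCK-MAJORANT CURRENCY

Cell `pub-ymgap`, seat `pub-ymgap-dag-n15-a` (KNIT-BY-NAME, g13); `--kind proof --supports stmt-QuantumFields-20294 --as helper`.  Over part 44 (`…TwoGridOutputSwap`: `sA_sub_one`,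
`hasMaj_shiftPull_sub`), part 41 (`hasMaj_gradStep`), part 40 (transfer calculus) and part 34 (`symbOp_sT_pow_comp_pull`, `symbOp_sD_sSm_comp_pull`).
WHY (entry 1 of [B9] (3.42) for Bałaban's pair `(G′, G)` at `U ≡ 1`, part 58).  With `D′ = ρ′(n′(s_ν−1))`, `D = ρ(n(s_ν−1))`, `P̂₂ = ρ′(Π_μa_μ²)∘P`:
`∇′_νG′P − P∇_νG = D′∘(G′P − P̂₂G) + (D′∘P̂₂ − P∘D)∘G`, and `D′∘P̂₂ = ρ′(a_νΠ_{μ≠ν}a_μ²)∘P∘D` EXACTLY (part 34).  Three algebraic inputs of the interpolation are typed here: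
(§68) the MEAN-VALUE identity `r·c(s−1) = c(s^r − 1) − Σ_{j<r}(s^j − 1)·c(s−1)` (a difference quotient = the quotient over `r` steps minus the average oscillation of the quotient),
as symbols and as operators; (§69) `ρ′(s_κ^{L^m·q})∘P = P∘ρ(s_κ^q)` (`q` coarse steps); (§70) the SMOOTHING-MINUS-ONE transfer: if `η∇_μS` has majorant `B·e^{−ρd}` for every `μ`
then `(ρ′(a_κ·Π_{ν∈s}a_ν²)∘P − P)∘S` has majorant `(2|s|+1)e^{2|s|ρ}·B·e^{−ρd}` (part 44 §33 averaged, one box filter at a time); (§71) ★★ `hasMaj_gradOutputSwap`: with `S = ∇_νG` and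
part 41's `η∇∇G = O(η^α)` the gradient-output swap `(ρ′(a_κΠ_{μ≠κ}a_μ²)∘P − P)∘ρ(n(s_ν−1))∘G` has the block majorant `C·(L^k)^{−α}·e^{−δd}` on the torus family of record, `∃ δ C > 0
∀ m_T, k ≥ 1, m, κ, ν` — HYPOTHESIS-FREE.
HONEST FRAMING ∕ LIMITS.  Finite lattice algebra + bookkeeping over tree theorems (`prop12_famG_printed` through parts 41∕42); constants crude; tori of record in §71; `U ≡ 1`; NO η-rate of
a (3.42) entry here (entry 1 is part 58); count-neutral (typed 28∕28 · discharged 5∕27 of record unchanged); NOT a discharge of N15 (object-bound; NE2⁺ NOT PRINTED); one finite T⁴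
at fixed ε — NOT infinite volume, NOT OS on ℝ⁴, NOT a mass gap, NOT Clay.
-/

noncomputable section

open scoped BigOperators
open Finset

namespace Summit.QuantumFields.YangMills.BalabanUVNodes.N15.TwoGrid

open Literature.MathematicalPhysics.QuantumFieldTheory.Balaban1983to89
open Literature.MathematicalPhysics.QuantumFieldTheory.Balaban1983to89.B11SectG (BlockNorm HasMaj hasMaj_zero)
open Literature.MathematicalPhysics.QuantumFieldTheory.Balaban1983to89.T4EtaRateCoeffDefect (pull pull_apply)
open Literature.MathematicalPhysics.QuantumFieldTheory.Balaban1983to89.B5Prop11Plancherel (Tor fine unitVec)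
open Literature.MathematicalPhysics.QuantumFieldTheory.Balaban1983to89.B5SiteBridgeP12 (MP)
open Literature.MathematicalPhysics.QuantumFieldTheory.King1986.Torus (blockOf tdistT tdistT_nonneg)
open Literature.MathematicalPhysics.QuantumFieldTheory.Balaban1983to89.B6UnitTorusCarrier (unitTorusGeo)
open Summit.QuantumFields.YangMills.BalabanUVNodes.N15.VectorPiece (blkFine kingPrV)

variable {d : ℕ}

/-! ## §68 The mean-value identity of the difference quotient -/

section MeanValue

variable (M : Fin (d + 1) → ℕ) (n : ℕ)

/-- `Σ_{j<r}(s_κ^j − 1)·c(s_κ − 1) = c·((s_κ^r − 1) − r·(s_κ − 1))` (geometric sum). [folklore] -/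
theorem sum_range_pow_sub_one_mul_sD (κ : Fin (d + 1)) (c : ℝ) (r : ℕ) :
    ∑ j ∈ range r, (sT M n κ ^ j - 1) * sD M n κ c = c • ((sT M n κ ^ r - 1) - (r : ℝ) • (sT M n κ - 1)) := by
  have hgeom : (∑ j ∈ range r, sT M n κ ^ j) * (sT M n κ - 1) = sT M n κ ^ r - 1 := geom_sum_mul _ _
  calc ∑ j ∈ range r, (sT M n κ ^ j - 1) * sD M n κ c
      = c • ∑ j ∈ range r, (sT M n κ ^ j * (sT M n κ - 1) - (sT M n κ - 1)) := by
        rw [smul_sum]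
        refine sum_congr rfl fun j _ => ?_
        rw [sD, mul_smul_comm, sub_mul, one_mul]
    _ = c • ((sT M n κ ^ r - 1) - (r : ℝ) • (sT M n κ - 1)) := by
        rw [sum_sub_distrib, ← sum_mul, hgeom, sum_const, card_range, ← Nat.cast_smul_eq_nsmul ℝ]

/-- **THE MEAN-VALUE IDENTITY (symbols)**: `r·c(s_κ − 1) = c·(s_κ^r − 1) − Σ_{j<r}(s_κ^j − 1)·c(s_κ − 1)` — the one-step difference quotient is the `r`-step quotient
`(c∕r)(s^r − 1)` minus the average over `j < r` of its own oscillation `(s^j − 1)·c(s − 1)`. [folklore] -/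
theorem sD_meanValue (κ : Fin (d + 1)) (c : ℝ) (r : ℕ) :
    (r : ℝ) • sD M n κ c = c • (sT M n κ ^ r - 1) - ∑ j ∈ range r, (sT M n κ ^ j - 1) * sD M n κ c := by
  rw [sum_range_pow_sub_one_mul_sD, smul_sub c (sT M n κ ^ r - 1), sub_sub_cancel, sD, smul_comm]

/-- **THE MEAN-VALUE IDENTITY (operators)**: `r·ρ(c(s_κ−1)) = c·ρ(s_κ^r − 1) − Σ_{j<r} ρ(s_κ^j − 1)∘ρ(c(s_κ−1))`. [folklore] -/
theorem symbOp_sD_meanValue (κ : Fin (d + 1)) (c : ℝ) (r : ℕ) :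
    (r : ℝ) • symbOp M n (sD M n κ c) = c • symbOp M n (sT M n κ ^ r - 1) - ∑ j ∈ range r, symbOp M n (sT M n κ ^ j - 1) ∘ₗ symbOp M n (sD M n κ c) := by
  rw [← map_smul, sD_meanValue, map_sub, map_smul, map_sum]
  congr 1
  exact sum_congr rfl fun j _ => by rw [map_mul, Module.End.mul_eq_comp]

end MeanValue

/-! ## §69 Iterated coarse shifts through King's prolongation: `ρ′(s_κ^{L^m·q})∘P = P∘ρ(s_κ^q)` -/

section Shifts

variable (M : Fin (d + 1) → ℕ) [∀ μ, NeZero (M μ)] (L k m : ℕ) [NeZero L]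

/-- **`q` COARSE STEPS = `L^m·q` FINE STEPS THROUGH THE PROLONGATION**: `ρ′(s_κ^{L^m·q})∘P = P∘ρ(s_κ^q)` (part 34's one-step intertwining iterated).
[cite: King1986, p.664 (pairing convention «x′ ∈ B^n(x)»)] -/
theorem symbOp_sT_pow_mul_comp_pull (κ : Fin (d + 1)) (q : ℕ) :
    symbOp M (L ^ m * L ^ k) (sT M (L ^ m * L ^ k) κ ^ (L ^ m * q)) ∘ₗ pull (kingPrV L k m M) =
      pull (kingPrV L k m M) ∘ₗ symbOp M (L ^ k) (sT M (L ^ k) κ ^ q) := by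
  induction q with
  | zero => simp only [mul_zero, pow_zero, map_one, Module.End.one_eq_id, LinearMap.id_comp, LinearMap.comp_id]
  | succ q ih =>
      rw [mul_add, mul_one, pow_add, pow_succ, map_mul, map_mul, Module.End.mul_eq_comp, Module.End.mul_eq_comp, LinearMap.comp_assoc,
        symbOp_sT_pow_comp_pull, ← LinearMap.comp_assoc, ih, LinearMap.comp_assoc]

/-- … applied to the `q`-step DIFFERENCE: `ρ′(s_κ^{L^m·q} − 1)∘P = P∘ρ(s_κ^q − 1)`. [folklore] -/
theorem symbOp_sT_pow_mul_sub_one_comp_pull (κ : Fin (d + 1)) (q : ℕ) :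
    symbOp M (L ^ m * L ^ k) (sT M (L ^ m * L ^ k) κ ^ (L ^ m * q) - 1) ∘ₗ pull (kingPrV L k m M) =
      pull (kingPrV L k m M) ∘ₗ symbOp M (L ^ k) (sT M (L ^ k) κ ^ q - 1) := by
  rw [map_sub, map_one, LinearMap.sub_comp, Module.End.one_eq_id, LinearMap.id_comp, symbOp_sT_pow_mul_comp_pull, map_sub, map_one,
    LinearMap.comp_sub, Module.End.one_eq_id, LinearMap.comp_id]

end Shifts

/-! ## §70 The smoothing-minus-one transfer through the prolongation: `(ρ′(a_κ·Π_{ν∈s}a_ν²)∘P − P)∘S` is dominated by `η∇S` -/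

section Smoothing

variable {L : ℕ} [NeZero L] (M : Fin (d + 1) → ℕ) [∀ μ, NeZero (M μ)] (k m : ℕ) {F₁ : Type} [AddCommGroup F₁] [Module ℝ F₁]

/-- **ONE BOX FILTER**: if `η∇_κS` has a majorant `B·e^{−ρd}` into coarse 1-forms (King unit blocks), then `(ρ′(a_κ(L^m))∘P − P)∘S` has the SAME majorant into fine 1-forms —
`a_κ − 1 = L^{−m}Σ_{j<L^m}(s_κ^j − 1)` (part 44 `sA_sub_one`) and each `(ρ′(s_κ^j)∘P − P)∘S` is dominated by `η∇_κS` (part 44 `hasMaj_shiftPull_sub`). [folklore] -/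
theorem hasMaj_sA_pull_sub {b₁ : BlockNorm (unitTorusGeo L k M) F₁} {S : F₁ →ₗ[ℝ] (Tor (fine (L ^ k) M) × Fin (d + 1) → ℝ)} {B ρ : ℝ}
    (hB : 0 ≤ B) (κ : Fin (d + 1))
    (h : HasMaj b₁ (BlockNorm.ofBlocks (unitTorusGeo L k M) (blkFine L k M)) ((((L ^ k : ℕ) : ℝ)⁻¹ • symbOp M (L ^ k) (sD M (L ^ k) κ ((L ^ k : ℕ) : ℝ))) ∘ₗ S)
      (fun y y' => B * Real.exp (-(ρ * tdistT M y y')))) :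
    HasMaj b₁ (BlockNorm.ofBlocks (unitTorusGeo L k M) (fun i : Tor (fine (L ^ m * L ^ k) M) × Fin (d + 1) => blockOf (L ^ m * L ^ k) M i.1))
      ((symbOp M (L ^ m * L ^ k) (sA M (L ^ m * L ^ k) κ (L ^ m)) ∘ₗ pull (kingPrV L k m M) - pull (kingPrV L k m M)) ∘ₗ S)
      (fun y y' => B * Real.exp (-(ρ * tdistT M y y'))) := by
  have hR0 : L ^ m ≠ 0 := pow_ne_zero m (NeZero.ne L)
  have hR' : (0 : ℝ) < ((L ^ m : ℕ) : ℝ) := by exact_mod_cast Nat.pos_of_ne_zero hR0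
  have hK0 : ∀ y y' : Tor M, 0 ≤ B * Real.exp (-(ρ * tdistT M y y')) := fun y y' => mul_nonneg hB (Real.exp_nonneg _)
  have hJ : ∀ j ∈ range (L ^ m), HasMaj b₁ (BlockNorm.ofBlocks (unitTorusGeo L k M) (fun i : Tor (fine (L ^ m * L ^ k) M) × Fin (d + 1) => blockOf (L ^ m * L ^ k) M i.1))
      ((symbOp M (L ^ m * L ^ k) (sT M (L ^ m * L ^ k) κ ^ j) ∘ₗ pull (kingPrV L k m M) - pull (kingPrV L k m M)) ∘ₗ S)
      (fun y y' => B * Real.exp (-(ρ * tdistT M y y'))) :=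
    fun j hj => hasMaj_shiftPull_sub M k m hK0 κ (mem_range.mp hj).le h
  have hsum := hasMaj_finsum (g := unitTorusGeo L k M) (b₁ := b₁)
    (b₂ := BlockNorm.ofBlocks (unitTorusGeo L k M) (fun i : Tor (fine (L ^ m * L ^ k) M) × Fin (d + 1) => blockOf (L ^ m * L ^ k) M i.1)) (range (L ^ m))
    (fun j => (symbOp M (L ^ m * L ^ k) (sT M (L ^ m * L ^ k) κ ^ j) ∘ₗ pull (kingPrV L k m M) - pull (kingPrV L k m M)) ∘ₗ S)
    (fun _ y y' => B * Real.exp (-(ρ * tdistT M y y'))) hJ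
  -- `(ρ′(a_κ)P − P)(Sμ) = ρ′(a_κ − 1)(P(Sμ)) = L^{−m}Σ_j (ρ′(s^j)P − P)(Sμ)`
  have hpt : ∀ μ : F₁, ((((L ^ m : ℕ) : ℝ)⁻¹ • ∑ j ∈ range (L ^ m), (symbOp M (L ^ m * L ^ k) (sT M (L ^ m * L ^ k) κ ^ j) ∘ₗ pull (kingPrV L k m M) - pull (kingPrV L k m M)) ∘ₗ S) μ
      = ((symbOp M (L ^ m * L ^ k) (sA M (L ^ m * L ^ k) κ (L ^ m)) ∘ₗ pull (kingPrV L k m M) - pull (kingPrV L k m M)) ∘ₗ S) μ) := by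
    intro μ
    have e1 : ((symbOp M (L ^ m * L ^ k) (sA M (L ^ m * L ^ k) κ (L ^ m)) ∘ₗ pull (kingPrV L k m M) - pull (kingPrV L k m M)) ∘ₗ S) μ
        = symbOp M (L ^ m * L ^ k) (sA M (L ^ m * L ^ k) κ (L ^ m) - 1) (pull (kingPrV L k m M) (S μ)) := by
      rw [LinearMap.comp_apply, LinearMap.sub_apply, LinearMap.comp_apply, map_sub, map_one, LinearMap.sub_apply, Module.End.one_apply]
    rw [e1, sA_sub_one M (L ^ m * L ^ k) κ hR0, map_smul, map_sum, LinearMap.smul_apply, LinearMap.sum_apply, LinearMap.smul_apply, LinearMap.sum_apply, Nat.cast_pow]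
    congr 1
    refine sum_congr rfl fun j _ => ?_
    rw [LinearMap.comp_apply, LinearMap.sub_apply, LinearMap.comp_apply, map_sub, map_one, LinearMap.sub_apply, Module.End.one_apply]
  refine ((hasMaj_smul_ofBlocks (g := unitTorusGeo L k M) (fun i : Tor (fine (L ^ m * L ^ k) M) × Fin (d + 1) => blockOf (L ^ m * L ^ k) M i.1)
    (fun y y' => sum_nonneg fun _ _ => hK0 y y') (((L ^ m : ℕ) : ℝ)⁻¹) hsum).congr hpt).mono fun y y' => le_of_eq ?_
  rw [sum_const, card_range, nsmul_eq_mul, abs_of_nonneg (inv_nonneg.mpr hR'.le), ← mul_assoc, inv_mul_cancel₀ hR'.ne', one_mul]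

/-- **ONE MORE BOX FILTER IN FRONT**: if `(ρ′(Y)∘P − P)∘S` has majorant `K_Y·e^{−ρd}` and `η∇_κS` has `B·e^{−ρd}`, then `(ρ′(a_κ·Y)∘P − P)∘S` has `(e^{ρ}K_Y + B)·e^{−ρd}`:
`ρ′(a_κY)∘P − P = ρ′(a_κ)∘(ρ′(Y)∘P − P) + (ρ′(a_κ)∘P − P)`. [folklore] -/
theorem hasMaj_sA_mul_pull_sub {b₁ : BlockNorm (unitTorusGeo L k M) F₁} {S : F₁ →ₗ[ℝ] (Tor (fine (L ^ k) M) × Fin (d + 1) → ℝ)} {B K ρ : ℝ}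
    (hB : 0 ≤ B) (hK : 0 ≤ K) (hρ : 0 ≤ ρ) (κ : Fin (d + 1)) (Y : AddMonoidAlgebra ℝ (Tor (fine (L ^ m * L ^ k) M)))
    (hS : HasMaj b₁ (BlockNorm.ofBlocks (unitTorusGeo L k M) (blkFine L k M)) ((((L ^ k : ℕ) : ℝ)⁻¹ • symbOp M (L ^ k) (sD M (L ^ k) κ ((L ^ k : ℕ) : ℝ))) ∘ₗ S)
      (fun y y' => B * Real.exp (-(ρ * tdistT M y y'))))
    (hY : HasMaj b₁ (BlockNorm.ofBlocks (unitTorusGeo L k M) (fun i : Tor (fine (L ^ m * L ^ k) M) × Fin (d + 1) => blockOf (L ^ m * L ^ k) M i.1))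
      ((symbOp M (L ^ m * L ^ k) Y ∘ₗ pull (kingPrV L k m M) - pull (kingPrV L k m M)) ∘ₗ S) (fun y y' => K * Real.exp (-(ρ * tdistT M y y')))) :
    HasMaj b₁ (BlockNorm.ofBlocks (unitTorusGeo L k M) (fun i : Tor (fine (L ^ m * L ^ k) M) × Fin (d + 1) => blockOf (L ^ m * L ^ k) M i.1))
      ((symbOp M (L ^ m * L ^ k) (sA M (L ^ m * L ^ k) κ (L ^ m) * Y) ∘ₗ pull (kingPrV L k m M) - pull (kingPrV L k m M)) ∘ₗ S)
      (fun y y' => (Real.exp ρ * K + B) * Real.exp (-(ρ * tdistT M y y'))) := by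
  have hL0 : 0 < L := Nat.pos_of_ne_zero (NeZero.ne L)
  have hR0 : L ^ m ≠ 0 := pow_ne_zero m (NeZero.ne L)
  have hRn : L ^ m ≤ L ^ m * L ^ k := Nat.le_mul_of_pos_right _ (Nat.one_le_pow _ _ hL0)
  have hsplit : (symbOp M (L ^ m * L ^ k) (sA M (L ^ m * L ^ k) κ (L ^ m) * Y) ∘ₗ pull (kingPrV L k m M) - pull (kingPrV L k m M)) ∘ₗ S
      = symbOp M (L ^ m * L ^ k) (sA M (L ^ m * L ^ k) κ (L ^ m)) ∘ₗ ((symbOp M (L ^ m * L ^ k) Y ∘ₗ pull (kingPrV L k m M) - pull (kingPrV L k m M)) ∘ₗ S)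
        + (symbOp M (L ^ m * L ^ k) (sA M (L ^ m * L ^ k) κ (L ^ m)) ∘ₗ pull (kingPrV L k m M) - pull (kingPrV L k m M)) ∘ₗ S := by
    rw [map_mul, Module.End.mul_eq_comp]
    ext μ i
    simp only [LinearMap.comp_apply, LinearMap.sub_apply, LinearMap.add_apply, map_sub, Pi.add_apply, Pi.sub_apply]
    ring
  rw [hsplit]
  have h1 := hasMaj_sA_comp M k (L ^ m * L ^ k) hK hρ κ hR0 hRn hY
  have h2 := hasMaj_sA_pull_sub M k m hB κ hS
  exact (h1.add h2).mono fun y y' => le_of_eq (by ring)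

/-- **THE SMOOTHING-MINUS-ONE TRANSFER**: if `η∇_μS` has majorant `B·e^{−ρd}` for EVERY direction `μ`, then for every finite set `s` of directions
`(ρ′(a_κ·Π_{ν∈s}a_ν²)∘P − P)∘S` has majorant `(2|s|+1)·e^{2|s|ρ}·B·e^{−ρd}` (induction on `s`, two box filters per inserted direction). [folklore] -/
theorem hasMaj_sA_prod_pull_sub {b₁ : BlockNorm (unitTorusGeo L k M) F₁} {S : F₁ →ₗ[ℝ] (Tor (fine (L ^ k) M) × Fin (d + 1) → ℝ)} {B ρ : ℝ}
    (hB : 0 ≤ B) (hρ : 0 ≤ ρ) (κ : Fin (d + 1))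
    (hS : ∀ μ : Fin (d + 1), HasMaj b₁ (BlockNorm.ofBlocks (unitTorusGeo L k M) (blkFine L k M))
      ((((L ^ k : ℕ) : ℝ)⁻¹ • symbOp M (L ^ k) (sD M (L ^ k) μ ((L ^ k : ℕ) : ℝ))) ∘ₗ S) (fun y y' => B * Real.exp (-(ρ * tdistT M y y'))))
    (s : Finset (Fin (d + 1))) :
    HasMaj b₁ (BlockNorm.ofBlocks (unitTorusGeo L k M) (fun i : Tor (fine (L ^ m * L ^ k) M) × Fin (d + 1) => blockOf (L ^ m * L ^ k) M i.1))
      ((symbOp M (L ^ m * L ^ k) (sA M (L ^ m * L ^ k) κ (L ^ m) * ∏ ν ∈ s, sA M (L ^ m * L ^ k) ν (L ^ m) ^ 2) ∘ₗ pull (kingPrV L k m M) - pull (kingPrV L k m M)) ∘ₗ S)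
      (fun y y' => (2 * s.card + 1) * Real.exp ρ ^ (2 * s.card) * B * Real.exp (-(ρ * tdistT M y y'))) := by
  classical
  induction s using Finset.induction_on with
  | empty =>
      rw [prod_empty, mul_one]
      exact (hasMaj_sA_pull_sub M k m hB κ (hS κ)).mono fun y y' => le_of_eq (by rw [card_empty]; push_cast; ring)
  | insert ν s hν ih =>
      have he1 : 1 ≤ Real.exp ρ := Real.one_le_exp hρ
      set Ks : ℝ := (2 * s.card + 1) * Real.exp ρ ^ (2 * s.card) * B with hKs
      have hKs0 : 0 ≤ Ks := mul_nonneg (mul_nonneg (by positivity) (pow_nonneg (Real.exp_nonneg _) _)) hB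
      -- `a_κ · (a_ν² · Π_s) = a_ν · (a_ν · (a_κ · Π_s))`
      have hsym : sA M (L ^ m * L ^ k) κ (L ^ m) * ∏ ν' ∈ insert ν s, sA M (L ^ m * L ^ k) ν' (L ^ m) ^ 2
          = sA M (L ^ m * L ^ k) ν (L ^ m) * (sA M (L ^ m * L ^ k) ν (L ^ m) * (sA M (L ^ m * L ^ k) κ (L ^ m) * ∏ ν' ∈ s, sA M (L ^ m * L ^ k) ν' (L ^ m) ^ 2)) := by
        rw [prod_insert hν]; ring
      rw [hsym]
      have h1 := hasMaj_sA_mul_pull_sub M k m hB hKs0 hρ ν _ (hS ν) ih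
      have hK1 : 0 ≤ Real.exp ρ * Ks + B := add_nonneg (mul_nonneg (Real.exp_nonneg _) hKs0) hB
      have h2 := hasMaj_sA_mul_pull_sub M k m hB hK1 hρ ν _ (hS ν) h1
      refine h2.mono fun y y' => mul_le_mul_of_nonneg_right ?_ (Real.exp_nonneg _)
      rw [card_insert_of_notMem hν]
      push_cast
      -- `e^ρ(e^ρ K_s + B) + B ≤ (2(|s|+1)+1)·e^{2(|s|+1)ρ}·B`
      have hpow : Real.exp ρ ^ (2 * (s.card + 1)) = Real.exp ρ ^ 2 * Real.exp ρ ^ (2 * s.card) := by rw [← pow_add]; ring_nf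
      have hP0 : 1 ≤ Real.exp ρ ^ (2 * s.card) := one_le_pow₀ he1
      have hP1 : 0 ≤ Real.exp ρ ^ (2 * s.card) := pow_nonneg (Real.exp_nonneg _) _
      rw [hpow, hKs]
      have hB2 : Real.exp ρ * B + B ≤ 2 * (Real.exp ρ ^ 2 * Real.exp ρ ^ (2 * s.card)) * B := by
        have h3 : Real.exp ρ ≤ Real.exp ρ ^ 2 * Real.exp ρ ^ (2 * s.card) := by
          calc Real.exp ρ = Real.exp ρ * 1 * 1 := by ring
            _ ≤ Real.exp ρ * Real.exp ρ * Real.exp ρ ^ (2 * s.card) := mul_le_mul (mul_le_mul_of_nonneg_left he1 (Real.exp_nonneg _)) hP0 zero_le_one (by positivity)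
            _ = Real.exp ρ ^ 2 * Real.exp ρ ^ (2 * s.card) := by ring
        have h4 : (1 : ℝ) ≤ Real.exp ρ ^ 2 * Real.exp ρ ^ (2 * s.card) := le_trans he1 h3
        nlinarith
      nlinarith [mul_nonneg (mul_nonneg (Real.exp_nonneg ρ) hP1) hB, sq_nonneg (Real.exp ρ)]

end Smoothing

/-! ## §71 ★★ THE GRADIENT-OUTPUT SWAP `(∇′_κP̂₂ − P∇_κ)∘G` IS `O(η^α)` IN BLOCK-MAJORANT CURRENCY, HYPOTHESIS-FREE -/

section GradSwap

variable {L : ℕ} [NeZero L]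

/-- `η·∇_μ∇_νG` has the block majorant `C·(L^k)^{−α}·e^{−δ₀d}` on the torus family of record (part 41 `hasMaj_gradStep` divided by `n = L^k`). [cite: Balaban1984PropagatorsI, Prop. 1.2 (1.111) p.35] -/
theorem hasMaj_inv_smul_gradStep (hL : Odd L ∧ 1 < L) {a : ℝ} (ha : 0 < a) {α : ℝ} (hα0 : 0 ≤ α) (hα1 : α < 1) :
    ∃ δ₀ C : ℝ, 0 < δ₀ ∧ 0 < C ∧ ∀ (mT k : ℕ) (hk : 1 ≤ k) (μ ν : Fin (d + 1)),
      HasMaj (BlockNorm.ofBlocks (unitTorusGeo L k (MP (paramsOf d L mT k hL))) (blkFine L k (MP (paramsOf d L mT k hL))))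
        (BlockNorm.ofBlocks (unitTorusGeo L k (MP (paramsOf d L mT k hL))) (blkFine L k (MP (paramsOf d L mT k hL))))
        ((((L ^ k : ℕ) : ℝ)⁻¹ • symbOp (MP (paramsOf d L mT k hL)) (L ^ k) (sD (MP (paramsOf d L mT k hL)) (L ^ k) μ ((L ^ k : ℕ) : ℝ))) ∘ₗ
          (symbOp (MP (paramsOf d L mT k hL)) (L ^ k) (sD (MP (paramsOf d L mT k hL)) (L ^ k) ν ((L ^ k : ℕ) : ℝ)) ∘ₗ gOp (MP (paramsOf d L mT k hL)) (L ^ k) a))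
        (fun y y' => C * ((L ^ k : ℕ) : ℝ) ^ (-α) * Real.exp (-(δ₀ * tdistT (MP (paramsOf d L mT k hL)) y y'))) := by
  obtain ⟨δ₀, C, hδ₀, hC, H⟩ := hasMaj_gradStep (d := d) hL ha hα0 hα1
  refine ⟨δ₀, C, hδ₀, hC, fun mT k hk μ ν => ?_⟩
  have hn0 : (0 : ℝ) < ((L ^ k : ℕ) : ℝ) := by exact_mod_cast Nat.one_le_pow _ _ (Nat.pos_of_ne_zero (NeZero.ne L))
  have h := H mT k hk μ ν
  rw [LinearMap.smul_comp]
  refine (hasMaj_smul_ofBlocks (g := unitTorusGeo L k (MP (paramsOf d L mT k hL))) (blkFine L k (MP (paramsOf d L mT k hL)))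
    (fun y y' => mul_nonneg (mul_nonneg hC.le (Real.rpow_nonneg hn0.le _)) (Real.exp_nonneg _)) (((L ^ k : ℕ) : ℝ)⁻¹) h).mono fun y y' => le_of_eq ?_
  rw [abs_of_nonneg (inv_nonneg.mpr hn0.le), show (-α) = (1 - α) + (-1 : ℝ) by ring, Real.rpow_add hn0, Real.rpow_neg_one]
  ring

/-- ★★ **THE GRADIENT-OUTPUT SWAP IS `O(η^α)`**: for odd `L > 1`, `a > 0`, `0 ≤ α < 1` there are `δ, C > 0` such that for every torus exponent `m_T`, every `k ≥ 1`, every refinement `m` and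
all directions `κ, ν`, the operator `(ρ′(a_κ·Π_{μ≠κ}a_μ²)∘P − P)∘ρ(L^k(s_ν−1))∘G` — which IS `(∇′_κ∘P̂₂ − P∘∇_κ)∘G` when `ν = κ` (part 34 `symbOp_sD_sSm_comp_pull`) — has the block
majorant `C·(L^k)^{−α}·e^{−δ|y−y′|_T}` from coarse 1-forms (King unit blocks) to fine 1-forms (unit blocks of the fine lattice): §70 at `S = ∇_νG` with §71's `η∇∇G = O(η^α)`.
[cite: Balaban1984PropagatorsI, Prop. 1.2 (1.111) p.35; King1986, Prop. 3.9 p.665 (η-rate shape)] -/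
theorem hasMaj_gradOutputSwap (hL : Odd L ∧ 1 < L) {a : ℝ} (ha : 0 < a) {α : ℝ} (hα0 : 0 ≤ α) (hα1 : α < 1) :
    ∃ δ C : ℝ, 0 < δ ∧ 0 < C ∧ ∀ (mT k m : ℕ) (hk : 1 ≤ k) (κ ν : Fin (d + 1)),
      HasMaj (BlockNorm.ofBlocks (unitTorusGeo L k (MP (paramsOf d L mT k hL))) (blkFine L k (MP (paramsOf d L mT k hL))))
        (BlockNorm.ofBlocks (unitTorusGeo L k (MP (paramsOf d L mT k hL)))
          (fun i : Tor (fine (L ^ m * L ^ k) (MP (paramsOf d L mT k hL))) × Fin (d + 1) => blockOf (L ^ m * L ^ k) (MP (paramsOf d L mT k hL)) i.1))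
        ((symbOp (MP (paramsOf d L mT k hL)) (L ^ m * L ^ k)
              (sA (MP (paramsOf d L mT k hL)) (L ^ m * L ^ k) κ (L ^ m) * ∏ μ ∈ univ.erase κ, sA (MP (paramsOf d L mT k hL)) (L ^ m * L ^ k) μ (L ^ m) ^ 2) ∘ₗ
            pull (kingPrV L k m (MP (paramsOf d L mT k hL))) - pull (kingPrV L k m (MP (paramsOf d L mT k hL)))) ∘ₗ
          (symbOp (MP (paramsOf d L mT k hL)) (L ^ k) (sD (MP (paramsOf d L mT k hL)) (L ^ k) ν ((L ^ k : ℕ) : ℝ)) ∘ₗ gOp (MP (paramsOf d L mT k hL)) (L ^ k) a))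
        (fun y y' => C * ((L ^ k : ℕ) : ℝ) ^ (-α) * Real.exp (-(δ * tdistT (MP (paramsOf d L mT k hL)) y y'))) := by
  obtain ⟨δ₀, C, hδ₀, hC, H⟩ := hasMaj_inv_smul_gradStep (d := d) hL ha hα0 hα1
  refine ⟨δ₀, (2 * d + 1) * Real.exp δ₀ ^ (2 * d) * C, hδ₀, by positivity, fun mT k m hk κ ν => ?_⟩
  have hn0 : (0 : ℝ) < ((L ^ k : ℕ) : ℝ) := by exact_mod_cast Nat.one_le_pow _ _ (Nat.pos_of_ne_zero (NeZero.ne L))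
  have hB : 0 ≤ C * ((L ^ k : ℕ) : ℝ) ^ (-α) := mul_nonneg hC.le (Real.rpow_nonneg hn0.le _)
  have h := hasMaj_sA_prod_pull_sub (L := L) (MP (paramsOf d L mT k hL)) k m
    (b₁ := BlockNorm.ofBlocks (unitTorusGeo L k (MP (paramsOf d L mT k hL))) (blkFine L k (MP (paramsOf d L mT k hL))))
    (S := symbOp (MP (paramsOf d L mT k hL)) (L ^ k) (sD (MP (paramsOf d L mT k hL)) (L ^ k) ν ((L ^ k : ℕ) : ℝ)) ∘ₗ gOp (MP (paramsOf d L mT k hL)) (L ^ k) a)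
    hB hδ₀.le κ (fun μ => H mT k hk μ ν) (univ.erase κ)
  -- (the two majorants agree; stated over `Tor M` so that both sides elaborate alike, then closed by defeq)
  have key : ∀ y y' : Tor (MP (paramsOf d L mT k hL)),
      (2 * ((univ.erase κ).card : ℝ) + 1) * Real.exp δ₀ ^ (2 * (univ.erase κ).card) * (C * ((L ^ k : ℕ) : ℝ) ^ (-α)) *
          Real.exp (-(δ₀ * tdistT (MP (paramsOf d L mT k hL)) y y'))
        = (2 * d + 1) * Real.exp δ₀ ^ (2 * d) * C * ((L ^ k : ℕ) : ℝ) ^ (-α) * Real.exp (-(δ₀ * tdistT (MP (paramsOf d L mT k hL)) y y')) := by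
    intro y y'
    rw [card_erase_of_mem (mem_univ κ), card_univ, Fintype.card_fin, Nat.add_sub_cancel]
    ring
  exact h.mono fun y y' => (key y y').le

end GradSwap

end Summit.QuantumFields.YangMills.BalabanUVNodes.N15.TwoGrid
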